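import Mathlib

/-!
# The symmetrised Euler factor `(ℓ − a ζ)(ℓ − a ζ⁻¹)` is a `p`-UNIT with an explicit integral cofactor
# (cyclotomic values; MEMO-an §71.2 side condition (iii) of the polar witness)

Summit `BirchSwinnertonDyer`, route `ManinLocalTwoThree` (cell bsd-f2-manin), cruxes C3 `ManinPrimeToThreeAtNine`
(stmt-BirchSwinnertonDyer-22968) / C2 `ManinOddAtFour` (stmt-…-22967).  The tree's polar witnesses
`…ManinAdditive.KatoCurve.ThreeAdicPolarWitness` / `TwoAdicPolarWitness` multiply the twisted symbol sum by the
multiplicative Euler factor `e_S(χ) = ∏_{ℓ ∥ N} (ℓ − a_ℓ χ(ℓ))(ℓ − a_ℓ χ̄(ℓ))`, `a_ℓ = ±1`.  To transport «`s·r/p` is never an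
algebraic integer» through this factor one needs, for each factor `e`, an algebraic integer `c` and an integer `t` prime to `p`
with `e·c = t`.  This file supplies them:

* `exists_cofactor_mul_eq_int_of_pow_ne_one` — for `a = ±1`, `ℓ ∈ ℕ` and a root of unity `ζ` of order prime to `p` with
  `ζ^{p-1} ≠ 1` and `ζ² ≠ 1`: `∃ c t, IsIntegral ℤ c ∧ (ℓ − aζ)(ℓ − aζ⁻¹)·c = t ∧ p ∤ t`.  Proof: `(ℓ − aζ)(ℓ − aζ⁻¹) =
  (aℓ − ζ)(aℓ − ζ⁻¹)`; with `d = ord ζ ≥ 3` the product of `aℓ − μ` over ALL primitive `d`-th roots `μ` is `Φ_d(aℓ) ∈ ℤ`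
  (`Polynomial.cyclotomic_eq_prod_X_sub_primitiveRoots`), and `p ∣ Φ_d(aℓ)` would make `aℓ` a primitive `d`-th root of unity
  mod `p` (`Polynomial.isRoot_cyclotomic_iff`, `p ∤ d`), forcing `d ∣ p − 1`, i.e. `ζ^{p-1} = 1`.
* `not_isIntegral_mul_of_cofactor` — the transport: if `e·c = t` with `c` integral, `p ∤ t`, and `s·r/p` is never integral
  for `p ∤ s`, then neither is `s·(e·r)/p`.

HONEST FRAMING: elementary algebra; nothing about modular forms, Manin's conjecture or BSD is asserted or proved here.
No definitions, no named facts, no sorry.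
-/

set_option linter.dupNamespace false
set_option autoImplicit false

noncomputable section

open scoped Classical
open Polynomial

namespace Summit.BirchSwinnertonDyer.BirchSwinnertonDyer.Theorems.ManinLocalTwoThree

/-- **Cyclotomic cofactor.**  Let `p` be a prime, `ℓ ∈ ℕ`, `a = ±1`, and `ζ ∈ ℂ` with `ζ ^ d = 1` for some `d > 0` prime to
`p`, `ζ ^ (p-1) ≠ 1` and `ζ ^ 2 ≠ 1`.  Then there are an algebraic integer `c` and an integer `t` with `p ∤ t` and
`(ℓ − aζ)(ℓ − aζ⁻¹) · c = t` — the symmetrised Euler factor is a unit above `p`. [folklore] -/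
theorem exists_cofactor_mul_eq_int_of_pow_ne_one {p : ℕ} (hp : p.Prime) (ℓ : ℕ) {a : ℤ} (ha : a = 1 ∨ a = -1)
    {ζ : ℂ} {d : ℕ} (hd : 0 < d) (hpd : ¬ p ∣ d) (hζd : ζ ^ d = 1) (hζp : ζ ^ (p - 1) ≠ 1) (hζ2 : ζ ^ 2 ≠ 1) :
    ∃ (c : ℂ) (t : ℤ), IsIntegral ℤ c ∧ ((ℓ : ℂ) - a * ζ) * ((ℓ : ℂ) - a * ζ⁻¹) * c = t ∧ ¬ (p : ℤ) ∣ t := by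
  -- the exact order `D` of `ζ`
  set D : ℕ := orderOf ζ with hD
  have hζD : IsPrimitiveRoot ζ D := IsPrimitiveRoot.orderOf ζ
  have hDd : D ∣ d := orderOf_dvd_of_pow_eq_one hζd
  have hD0 : 0 < D := Nat.pos_of_ne_zero fun h ↦ by
    rw [h, zero_dvd_iff] at hDd; omega
  have hpD : ¬ p ∣ D := fun h ↦ hpd (h.trans hDd)
  have hζne : ζ ≠ ζ⁻¹ := by
    intro h
    apply hζ2
    have hζ0 : ζ ≠ 0 := hζD.ne_zero hD0.ne'
    rw [pow_two]
    nth_rewrite 2 [h]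
    exact mul_inv_cancel₀ hζ0
  -- `a² = 1`, so `(ℓ − aζ)(ℓ − aζ⁻¹) = (aℓ − ζ)(aℓ − ζ⁻¹)`
  have ha2 : (a : ℂ) * a = 1 := by rcases ha with rfl | rfl <;> norm_num
  set x : ℂ := (a : ℂ) * ℓ with hx
  have hfac : ((ℓ : ℂ) - a * ζ) * ((ℓ : ℂ) - a * ζ⁻¹) = (x - ζ) * (x - ζ⁻¹) := by
    rw [hx]; linear_combination (-((ℓ : ℂ) ^ 2 - ζ * ζ⁻¹)) * ha2
  -- the primitive `D`-th roots and the cofactor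
  set P : Finset ℂ := primitiveRoots D ℂ with hP
  have hζP : ζ ∈ P := (mem_primitiveRoots hD0).mpr hζD
  have hζiP : ζ⁻¹ ∈ P.erase ζ := Finset.mem_erase.mpr ⟨hζne.symm, (mem_primitiveRoots hD0).mpr hζD.inv⟩
  set c : ℂ := ∏ μ ∈ (P.erase ζ).erase ζ⁻¹, (x - μ) with hc
  have hprod : (x - ζ) * (x - ζ⁻¹) * c = ∏ μ ∈ P, (x - μ) := by
    rw [hc, mul_assoc, Finset.mul_prod_erase (P.erase ζ) (fun μ ↦ x - μ) hζiP,
      Finset.mul_prod_erase P (fun μ ↦ x - μ) hζP]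
  -- `∏_{μ ∈ P} (x − μ) = Φ_D(x) = Φ_D(aℓ) ∈ ℤ`
  have hcyc : ∏ μ ∈ P, (x - μ) = ((Polynomial.cyclotomic D ℤ).eval (a * ℓ) : ℤ) := by
    have h1 : (Polynomial.cyclotomic D ℂ).eval x = ∏ μ ∈ P, (x - μ) := by
      rw [hP, Polynomial.cyclotomic_eq_prod_X_sub_primitiveRoots hζD, Polynomial.eval_prod]
      simp only [Polynomial.eval_sub, Polynomial.eval_X, Polynomial.eval_C]
    rw [← h1, ← Polynomial.map_cyclotomic_int D ℂ, hx]
    have : ((a : ℂ) * ℓ) = ((a * ℓ : ℤ) : ℂ) := by push_cast; ring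
    rw [this, Polynomial.eval_intCast_map, eq_intCast, Int.cast_id]
  refine ⟨c, (Polynomial.cyclotomic D ℤ).eval (a * ℓ), ?_, ?_, ?_⟩
  · -- `c` is an algebraic integer
    refine IsIntegral.prod _ fun μ hμ ↦ ?_
    have hμP : μ ∈ P := Finset.mem_of_mem_erase (Finset.mem_of_mem_erase hμ)
    have hμ : IsPrimitiveRoot μ D := (mem_primitiveRoots hD0).mp hμP
    refine IsIntegral.sub ?_ (hμ.isIntegral hD0)
    rw [hx]
    exact (isIntegral_algebraMap (R := ℤ) (x := a)).mul (by simpa using isIntegral_algebraMap (R := ℤ) (A := ℂ) (x := (ℓ : ℤ)))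
  · rw [hfac, hprod, hcyc]
  · -- `p ∤ Φ_D(aℓ)`: otherwise `aℓ` is a primitive `D`-th root of unity mod `p`, so `D ∣ p − 1`
    intro hdiv
    haveI : Fact p.Prime := ⟨hp⟩
    haveI : NeZero (D : ZMod p) := ⟨by
      rw [Ne, ZMod.natCast_eq_zero_iff]
      exact hpD⟩
    have hroot : (Polynomial.cyclotomic D (ZMod p)).IsRoot (((a * ℓ : ℤ)) : ZMod p) := by
      rw [Polynomial.IsRoot, ← Polynomial.map_cyclotomic_int D (ZMod p), Polynomial.eval_intCast_map, eq_intCast,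
        Int.cast_id, (ZMod.intCast_zmod_eq_zero_iff_dvd _ p).mpr hdiv]
    have hprim : IsPrimitiveRoot (((a * ℓ : ℤ)) : ZMod p) D := Polynomial.isRoot_cyclotomic_iff.mp hroot
    have hne0 : (((a * ℓ : ℤ)) : ZMod p) ≠ 0 := hprim.ne_zero hD0.ne'
    have hDp : D ∣ p - 1 := hprim.dvd_of_pow_eq_one _ (ZMod.pow_card_sub_one_eq_one hne0)
    apply hζp
    obtain ⟨k, hk⟩ := hDp
    rw [hk, pow_mul, hζD.pow_eq_one, one_pow]

/-- **Transport of the unit clause through a `p`-unit factor**: if `e·c = t` with `c` an algebraic integer and `p ∤ t`,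
and `s·r/p` is not an algebraic integer for any `s` prime to `p`, then `s·(e·r)/p` is not an algebraic integer for any `s`
prime to `p`. [folklore] -/
theorem not_isIntegral_mul_of_cofactor {p : ℕ} (hp : p.Prime) {e c r : ℂ} {t : ℤ} (hc : IsIntegral ℤ c)
    (het : e * c = t) (hpt : ¬ (p : ℤ) ∣ t) (hr : ∀ s : ℕ, ¬ p ∣ s → ¬ IsIntegral ℤ ((s : ℂ) * r / p))
    (s : ℕ) (hs : ¬ p ∣ s) : ¬ IsIntegral ℤ ((s : ℂ) * (e * r) / p) := by
  intro hI
  -- multiply by the cofactor: `s·t·r/p` is integral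
  have h1 : IsIntegral ℤ (((s * t.natAbs : ℕ) : ℂ) * r / p) := by
    have e1 : (((s * t.natAbs : ℕ) : ℂ) * r / p) = ((t.sign : ℤ) : ℂ) * (c * ((s : ℂ) * (e * r) / p)) := by
      have hn : ((t.natAbs : ℕ) : ℂ) = ((t.sign : ℤ) : ℂ) * (t : ℂ) := by
        rw [Nat.cast_natAbs, ← Int.sign_mul_self_eq_abs]; push_cast; ring
      have e2 : ((t.sign : ℤ) : ℂ) * (c * ((s : ℂ) * (e * r) / p)) = ((t.sign : ℤ) : ℂ) * (e * c) * ((s : ℂ) * r) / p := by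
        ring
      rw [e2, het, Nat.cast_mul, hn]
      ring
    rw [e1]
    exact (isIntegral_algebraMap (R := ℤ) (x := t.sign)).mul (hc.mul hI)
  refine hr (s * t.natAbs) ?_ h1
  intro h
  rcases (Nat.Prime.dvd_mul hp).mp h with h' | h'
  · exact hs h'
  · exact hpt (Int.natCast_dvd.mpr h')

end Summit.BirchSwinnertonDyer.BirchSwinnertonDyer.Theorems.ManinLocalTwoThree

end
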